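import Mathlib
import Summits.NavierStokesRegularity.NavierStokesRegularity.Theorems.FilamentSkeletonRssDefectColumnGateAzimuthalBlockCore

/-!
# Route `FilamentSkeletonRss` · crux `TransverseReduction1AG` (stmt-NavierStokesRegularity-27853; A1L twin stmt-23297) · line
# `defect_column_gate_1AG/1AL` — the TRUNCATED Gaussian-core rotation coercivity of the Biot–Savart-coupled azimuthal blocks `m ≥ 2` of
# S2a-loc `WaistColumnGateLoc1A`: the `1/Rc` gain on a core `[0, u₁]`, with the boundary flux at `u₁` and the exterior Biot–Savart remainder
# explicit — brick (Im) of the seat's two-zone scheme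

Helper file (`--supports stmt-NavierStokesRegularity-27853 --as helper`; seat ns-filament-s2aloc-p1 g2; note ARCHITECTURE-B2B3-s2aloc-g2.md v2 §6).
Built on `…AzimuthalBlockCore.lean` (p672582: the support version `u₁ = U`) and `…AzimuthalBlockRotationFlux.lean` (p672041/p672794).

WHY TRUNCATE.  The Gaussian weight `E = e^{γu/4}` is affordable only up to `u₀ ≍ (4A/γ)·log Rc` (`E(u₀) = Rc^A`); beyond, the V-blind exterior
lemma (`azimuthalBlock_exterior`, p671778) takes over.  So the core identities are needed on `[0, u₁]`, `u₁` in a layer above `u₀`, with (a) the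
boundary flux `E(u₁)(aΦ_b − bΦ_a)(u₁) = E(u₁)·4u₁·Im(w̄w′)(u₁)` kept (it is later made small by choosing `u₁` in the layer, `exists_mul_le_integral`),
and (b) the Biot–Savart pairing truncated WITHOUT any boundary term or decay estimate for `φ`: by AM–GM on `[0,u₁]` and the GLOBAL pairing bound
`∫₀^U (4uφ′² + m²φ²/u) = ∫₀^U aφ_a ≤ (1/m²)∫₀^U u a²` (`bsPairing_le`), `∫₀^{u₁} aφ_a ≤ (1/m²)∫₀^{u₁} u a² + (1/(2m²))∫_{u₁}^U u a²`
(`bsPairing_trunc_le`) — the exterior remainder is a sup-controlled quantity (`≤ S_ext²/(4m²u₁²)` in the scheme).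

THE RESULT (`core_rotation_coercivity_trunc`; dictionary as in `…AzimuthalBlockCore.lean`): for `m ≥ 2`, every `Rc ≥ 0`, every `ρ`, `0 ≤ u₁ ≤ U`:
`(1 − 16/(5m²))·mRc ∫₀^{u₁} EΩ(a²+b²) + mρ ∫₀^{u₁} E(a²+b²)
   ≤ ∫₀^{u₁} E(a f₂ − b f₁) + E(u₁)(aΦ_b − bΦ_a)(u₁) + (γ²Rc/(16πm)) ∫_{u₁}^U u(a²+b²)`,
with `core_rotation_identity_trunc` the exact identity behind it.  HONEST FRAMING: identities/inequalities about ONE family of blocks of ONE linear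
MODEL operator of a hypothetical blow-up route (MODEL rung, negative side); nothing here bears on NS regularity.
-/

set_option linter.dupNamespace false

noncomputable section

namespace Summit.NavierStokesRegularity.NavierStokesRegularity.Theorems.DefectColumnGate

open scoped Topology
open Set Filter MeasureTheory intervalIntegral

/-- Sub-interval integrability on `[0, u₁] ⊂ [0, U]`. -/
theorem intervalIntegrable_mono_left {g : ℝ → ℝ} {u₁ U : ℝ} (hu₁ : 0 ≤ u₁) (hu₁U : u₁ ≤ U)
    (h : IntervalIntegrable g volume 0 U) : IntervalIntegrable g volume 0 u₁ :=
  h.mono_set (by rw [uIcc_of_le hu₁, uIcc_of_le (hu₁.trans hu₁U)]; exact Icc_subset_Icc le_rfl hu₁U)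

/-- Sub-interval integrability on `[u₁, U] ⊂ [0, U]`. -/
theorem intervalIntegrable_mono_right {g : ℝ → ℝ} {u₁ U : ℝ} (hu₁ : 0 ≤ u₁) (hu₁U : u₁ ≤ U)
    (h : IntervalIntegrable g volume 0 U) : IntervalIntegrable g volume u₁ U :=
  h.mono_set (by rw [uIcc_of_le hu₁U, uIcc_of_le (hu₁.trans hu₁U)]; exact Icc_subset_Icc hu₁ le_rfl)

/-- **Truncated Biot–Savart pairing bound (no boundary term).**  Under the global hypotheses of `bsPairing_le` on `[0,U]` plus integrability
of `aφ` and `u a²` on `[0,U]`: for `0 ≤ u₁ ≤ U`, `∫₀^{u₁} aφ ≤ (1/m²)∫₀^{u₁} u a² + (1/(2m²))∫_{u₁}^U u a²`. -/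
theorem bsPairing_trunc_le {m u₁ U : ℝ} {a φ φ₁ : ℝ → ℝ} (hm : m ≠ 0) (hu₁ : 0 ≤ u₁) (hu₁U : u₁ ≤ U)
    (hφ : ContinuousOn φ (Icc 0 U)) (hP : ContinuousOn (fun s => s * φ₁ s) (Icc 0 U)) (hφ0 : φ 0 = 0)
    (hder : ∀ u ∈ Ioo 0 U, HasDerivAt φ (φ₁ u) u)
    (hflux : ∀ u ∈ Ioo 0 U, HasDerivAt (fun s => s * φ₁ s) ((m ^ 2 / u * φ u - a u) / 4) u)
    (hφU : φ U = 0)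
    (hIaφ : IntervalIntegrable (fun u => a u * φ u) volume 0 U)
    (hIB₁ : IntervalIntegrable (fun u => 4 * u * φ₁ u ^ 2) volume 0 U)
    (hIB₂ : IntervalIntegrable (fun u => m ^ 2 / u * φ u ^ 2) volume 0 U)
    (hIua : IntervalIntegrable (fun u => u * a u ^ 2) volume 0 U) :
    ∫ u in (0:ℝ)..u₁, a u * φ u
      ≤ 1 / m ^ 2 * (∫ u in (0:ℝ)..u₁, u * a u ^ 2) + 1 / (2 * m ^ 2) * ∫ u in u₁..U, u * a u ^ 2 := by
  have hm2 : 0 < m ^ 2 := by positivity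
  have hU : 0 ≤ U := hu₁.trans hu₁U
  -- global facts
  have hglob := bsPairing_le hm hU hφ hP hφ0 hder hflux hφU hIaφ hIB₁ hIB₂ hIua
  have hid := bsPairing_integral hU hφ hP hder hflux hφU hIaφ (hIB₁.add hIB₂)
  -- truncated integrability
  have hIaφ' := intervalIntegrable_mono_left hu₁ hu₁U hIaφ
  have hIB₂' := intervalIntegrable_mono_left hu₁ hu₁U hIB₂
  have hIua' := intervalIntegrable_mono_left hu₁ hu₁U hIua
  -- AM–GM on `[0, u₁]`
  have hamgm : ∫ u in (0:ℝ)..u₁, a u * φ u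
      ≤ ∫ u in (0:ℝ)..u₁, ((1 / m ^ 2) * (u * a u ^ 2) + m ^ 2 / u * φ u ^ 2) / 2 := by
    apply integral_mono_on hu₁ hIaφ' (((hIua'.const_mul (1 / m ^ 2)).add hIB₂').div_const 2)
    intro u hu
    rcases eq_or_lt_of_le hu.1 with h | h
    · subst h; simp [hφ0]
    · have key : 0 ≤ (u * a u - m ^ 2 * φ u) ^ 2 / (2 * m ^ 2 * u) := by positivity
      have e : ((1 / m ^ 2) * (u * a u ^ 2) + m ^ 2 / u * φ u ^ 2) / 2 - a u * φ u
          = (u * a u - m ^ 2 * φ u) ^ 2 / (2 * m ^ 2 * u) := by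
        field_simp; ring
      linarith [e, key]
  have hsplit₁ : ∫ u in (0:ℝ)..u₁, ((1 / m ^ 2) * (u * a u ^ 2) + m ^ 2 / u * φ u ^ 2) / 2
      = ((1 / m ^ 2) * (∫ u in (0:ℝ)..u₁, u * a u ^ 2) + ∫ u in (0:ℝ)..u₁, m ^ 2 / u * φ u ^ 2) / 2 := by
    rw [intervalIntegral.integral_div, integral_add (hIua'.const_mul _) hIB₂', intervalIntegral.integral_const_mul]
  rw [hsplit₁] at hamgm
  -- `∫₀^{u₁} (m²/u)φ² ≤ ∫₀^U (m²/u)φ² ≤ ∫₀^U (4uφ₁² + (m²/u)φ²) = ∫₀^U aφ ≤ (1/m²)∫₀^U u a²`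
  have hmonoB : ∫ u in (0:ℝ)..u₁, m ^ 2 / u * φ u ^ 2 ≤ ∫ u in (0:ℝ)..U, m ^ 2 / u * φ u ^ 2 := by
    apply integral_mono_interval le_rfl hu₁ hu₁U
    · refine MeasureTheory.ae_restrict_of_forall_mem measurableSet_Ioc (fun u hu => ?_)
      have : 0 < u := hu.1
      positivity
    · exact hIB₂
  have hB₁ : 0 ≤ ∫ u in (0:ℝ)..U, 4 * u * φ₁ u ^ 2 :=
    integral_nonneg hU (fun u hu => by have := hu.1; positivity)
  have hsum : ∫ u in (0:ℝ)..U, (4 * u * φ₁ u ^ 2 + m ^ 2 / u * φ u ^ 2)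
      = (∫ u in (0:ℝ)..U, 4 * u * φ₁ u ^ 2) + ∫ u in (0:ℝ)..U, m ^ 2 / u * φ u ^ 2 := integral_add hIB₁ hIB₂
  have hchain : ∫ u in (0:ℝ)..u₁, m ^ 2 / u * φ u ^ 2 ≤ 1 / m ^ 2 * ∫ u in (0:ℝ)..U, u * a u ^ 2 := by
    have h1 : ∫ u in (0:ℝ)..U, m ^ 2 / u * φ u ^ 2 ≤ ∫ u in (0:ℝ)..U, a u * φ u := by rw [hid, hsum]; linarith
    linarith [hglob.2]
  -- split `∫₀^U u a² = ∫₀^{u₁} + ∫_{u₁}^U`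
  have hsplitU : ∫ u in (0:ℝ)..U, u * a u ^ 2 = (∫ u in (0:ℝ)..u₁, u * a u ^ 2) + ∫ u in u₁..U, u * a u ^ 2 :=
    (integral_add_adjacent_intervals hIua' (intervalIntegrable_mono_right hu₁ hu₁U hIua)).symm
  rw [hsplitU] at hchain
  set A₁ : ℝ := ∫ u in (0:ℝ)..u₁, u * a u ^ 2 with hA₁
  set A₂ : ℝ := ∫ u in u₁..U, u * a u ^ 2 with hA₂
  set B₁ : ℝ := ∫ u in (0:ℝ)..u₁, m ^ 2 / u * φ u ^ 2 with hB₁def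
  have h2 : ((1 / m ^ 2) * A₁ + B₁) / 2 ≤ ((1 / m ^ 2) * A₁ + 1 / m ^ 2 * (A₁ + A₂)) / 2 := by linarith [hchain]
  have e : ((1 / m ^ 2) * A₁ + 1 / m ^ 2 * (A₁ + A₂)) / 2 = 1 / m ^ 2 * A₁ + 1 / (2 * m ^ 2) * A₂ := by
    field_simp
    ring
  linarith [hamgm, h2, e]

/-- **Truncated core rotation identity (boundary flux kept).**  For `0 ≤ u₁ ≤ U` under the hypotheses of `core_rotation_identity` (continuity on
`[0,U]`, the coupled block on `(0,U)`, integrability on `[0,U]`):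
`∫₀^{u₁} E V (a²+b²) = ∫₀^{u₁} E(a f₂ − b f₁) + (γ²mRc/8π)∫₀^{u₁}(aφ_a + bφ_b) + E(u₁)·(aΦ_b − bΦ_a)(u₁)`. -/
theorem core_rotation_identity_trunc {γ m ρ Rc u₁ U : ℝ} {a a₁ b b₁ φa φb f₁ f₂ : ℝ → ℝ} (hu₁ : 0 ≤ u₁) (hu₁U : u₁ ≤ U)
    (ha : ContinuousOn a (Icc 0 U)) (hb : ContinuousOn b (Icc 0 U))
    (hΦac : ContinuousOn (fun s => 4 * s * a₁ s + γ * s * a s) (Icc 0 U))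
    (hΦbc : ContinuousOn (fun s => 4 * s * b₁ s + γ * s * b s) (Icc 0 U))
    (hdera : ∀ u ∈ Ioo 0 U, HasDerivAt a (a₁ u) u) (hderb : ∀ u ∈ Ioo 0 U, HasDerivAt b (b₁ u) u)
    (hΦa : ∀ u ∈ Ioo 0 U, HasDerivAt (fun s => 4 * s * a₁ s + γ * s * a s)
      (m ^ 2 / u * a u - m * (ρ + Rc * ((1 - Real.exp (-(γ * u / 4))) / (2 * Real.pi * u))) * b u
        + γ * m * Rc / 2 * (γ / (4 * Real.pi) * Real.exp (-(γ * u / 4))) * φb u - f₁ u) u)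
    (hΦb : ∀ u ∈ Ioo 0 U, HasDerivAt (fun s => 4 * s * b₁ s + γ * s * b s)
      (m ^ 2 / u * b u + m * (ρ + Rc * ((1 - Real.exp (-(γ * u / 4))) / (2 * Real.pi * u))) * a u
        - γ * m * Rc / 2 * (γ / (4 * Real.pi) * Real.exp (-(γ * u / 4))) * φa u - f₂ u) u)
    (hIV : IntervalIntegrable (fun u => Real.exp (γ * u / 4)
      * (m * (ρ + Rc * ((1 - Real.exp (-(γ * u / 4))) / (2 * Real.pi * u))) * (a u ^ 2 + b u ^ 2))) volume 0 U)
    (hIf : IntervalIntegrable (fun u => Real.exp (γ * u / 4) * (a u * f₂ u - b u * f₁ u)) volume 0 U)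
    (hIbs : IntervalIntegrable (fun u => a u * φa u + b u * φb u) volume 0 U) :
    ∫ u in (0:ℝ)..u₁, Real.exp (γ * u / 4)
        * (m * (ρ + Rc * ((1 - Real.exp (-(γ * u / 4))) / (2 * Real.pi * u))) * (a u ^ 2 + b u ^ 2))
      = (∫ u in (0:ℝ)..u₁, Real.exp (γ * u / 4) * (a u * f₂ u - b u * f₁ u))
        + γ ^ 2 * m * Rc / (8 * Real.pi) * (∫ u in (0:ℝ)..u₁, (a u * φa u + b u * φb u))
        + Real.exp (γ * u₁ / 4) * (a u₁ * (4 * u₁ * b₁ u₁ + γ * u₁ * b u₁) - b u₁ * (4 * u₁ * a₁ u₁ + γ * u₁ * a u₁)) := by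
  have hπ : Real.pi ≠ 0 := Real.pi_pos.ne'
  have hsub : Icc 0 u₁ ⊆ Icc 0 U := Icc_subset_Icc le_rfl hu₁U
  have hsubo : Ioo 0 u₁ ⊆ Ioo 0 U := Ioo_subset_Ioo le_rfl hu₁U
  set V : ℝ → ℝ := fun u => m * (ρ + Rc * ((1 - Real.exp (-(γ * u / 4))) / (2 * Real.pi * u))) with hVdef
  set cB : ℝ → ℝ := fun u => γ * m * Rc / 2 * (γ / (4 * Real.pi) * Real.exp (-(γ * u / 4))) with hcBdef
  set F₁ : ℝ → ℝ := fun u => f₁ u - cB u * φb u with hF₁def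
  set F₂ : ℝ → ℝ := fun u => f₂ u + cB u * φa u with hF₂def
  have hEcB : ∀ u, Real.exp (γ * u / 4) * cB u = γ ^ 2 * m * Rc / (8 * Real.pi) := by
    intro u
    simp only [hcBdef]
    have hE : Real.exp (γ * u / 4) ≠ 0 := (Real.exp_pos _).ne'
    rw [Real.exp_neg]
    field_simp
    ring
  set Fl : ℝ → ℝ := fun s => Real.exp (γ * s / 4)
      * (a s * (4 * s * b₁ s + γ * s * b s) - b s * (4 * s * a₁ s + γ * s * a s)) with hFldef
  have hcont : ContinuousOn Fl (Icc 0 u₁) := by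
    have hE : ContinuousOn (fun s : ℝ => Real.exp (γ * s / 4)) (Icc 0 u₁) :=
      (Real.continuous_exp.comp (by continuity)).continuousOn
    exact hE.mul (((ha.mono hsub).mul (hΦbc.mono hsub)).sub ((hb.mono hsub).mul (hΦac.mono hsub)))
  have hderiv : ∀ u ∈ Ioo 0 u₁, HasDerivAt Fl
      (Real.exp (γ * u / 4) * (V u * (a u ^ 2 + b u ^ 2) - (a u * F₂ u - b u * F₁ u))) u := by
    intro u hu
    have hu' := hsubo hu
    have hA : HasDerivAt (fun s => 4 * s * a₁ s + γ * s * a s) (m ^ 2 / u * a u - V u * b u - F₁ u) u :=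
      (hΦa u hu').congr_deriv (by simp only [hVdef, hF₁def, hcBdef]; ring)
    have hB : HasDerivAt (fun s => 4 * s * b₁ s + γ * s * b s) (m ^ 2 / u * b u + V u * a u - F₂ u) u :=
      (hΦb u hu').congr_deriv (by simp only [hVdef, hF₂def, hcBdef]; ring)
    exact rotationFlux_gauss_hasDerivAt (hdera u hu') (hderb u hu') hA hB
  have hint_eq : ∀ u, Real.exp (γ * u / 4) * (V u * (a u ^ 2 + b u ^ 2) - (a u * F₂ u - b u * F₁ u))
      = Real.exp (γ * u / 4) * (V u * (a u ^ 2 + b u ^ 2))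
        - Real.exp (γ * u / 4) * (a u * f₂ u - b u * f₁ u)
        - γ ^ 2 * m * Rc / (8 * Real.pi) * (a u * φa u + b u * φb u) := by
    intro u
    have h := hEcB u
    simp only [hF₁def, hF₂def]
    linear_combination (-(a u * φa u + b u * φb u)) * h
  have hIV' := intervalIntegrable_mono_left hu₁ hu₁U hIV
  have hIf' := intervalIntegrable_mono_left hu₁ hu₁U hIf
  have hIbs' := intervalIntegrable_mono_left hu₁ hu₁U hIbs
  have hint : IntervalIntegrable (fun u => Real.exp (γ * u / 4)
      * (V u * (a u ^ 2 + b u ^ 2) - (a u * F₂ u - b u * F₁ u))) volume 0 u₁ := by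
    have e : (fun u => Real.exp (γ * u / 4) * (V u * (a u ^ 2 + b u ^ 2) - (a u * F₂ u - b u * F₁ u)))
        = fun u => Real.exp (γ * u / 4) * (V u * (a u ^ 2 + b u ^ 2))
          - Real.exp (γ * u / 4) * (a u * f₂ u - b u * f₁ u)
          - γ ^ 2 * m * Rc / (8 * Real.pi) * (a u * φa u + b u * φb u) := by
      funext u; exact hint_eq u
    rw [e]
    exact (hIV'.sub hIf').sub (hIbs'.const_mul (γ ^ 2 * m * Rc / (8 * Real.pi)))
  have hFTC := integral_eq_sub_of_hasDerivAt_of_le hu₁ hcont hderiv hint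
  have hFl0 : Fl 0 = 0 := by simp [hFldef]
  rw [hFl0, sub_zero] at hFTC
  have hsplit : ∫ u in (0:ℝ)..u₁, Real.exp (γ * u / 4) * (V u * (a u ^ 2 + b u ^ 2) - (a u * F₂ u - b u * F₁ u))
      = (∫ u in (0:ℝ)..u₁, Real.exp (γ * u / 4) * (V u * (a u ^ 2 + b u ^ 2)))
        - (∫ u in (0:ℝ)..u₁, Real.exp (γ * u / 4) * (a u * f₂ u - b u * f₁ u))
        - γ ^ 2 * m * Rc / (8 * Real.pi) * ∫ u in (0:ℝ)..u₁, (a u * φa u + b u * φb u) := by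
    rw [← intervalIntegral.integral_const_mul, ← integral_sub hIV' hIf',
      ← integral_sub (hIV'.sub hIf') (hIbs'.const_mul _)]
    congr 1; funext u; rw [hint_eq u]
  rw [hsplit] at hFTC
  have hFlu₁ : Fl u₁ = Real.exp (γ * u₁ / 4)
      * (a u₁ * (4 * u₁ * b₁ u₁ + γ * u₁ * b u₁) - b u₁ * (4 * u₁ * a₁ u₁ + γ * u₁ * a u₁)) := rfl
  rw [hFlu₁] at hFTC
  linarith

set_option maxHeartbeats 800000 in
/-- **Truncated core rotation coercivity (`m ≥ 2`, every `Rc ≥ 0`, boundary flux and exterior Biot–Savart remainder explicit).**  Under the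
hypotheses of `core_rotation_coercivity` (global on `[0,U]`) and `0 ≤ u₁ ≤ U`:
`(1 − 16/(5m²))·mRc ∫₀^{u₁} EΩ(a²+b²) + mρ∫₀^{u₁} E(a²+b²) ≤ ∫₀^{u₁} E(a f₂ − b f₁) + E(u₁)(aΦ_b − bΦ_a)(u₁) + (γ²Rc/(16πm))∫_{u₁}^U u(a²+b²)`. -/
theorem core_rotation_coercivity_trunc {γ m ρ Rc u₁ U : ℝ} {a a₁ b b₁ φa φa₁ φb φb₁ f₁ f₂ : ℝ → ℝ}
    (hγ : 0 < γ) (hm : 2 ≤ m) (hRc : 0 ≤ Rc) (hu₁ : 0 ≤ u₁) (hu₁U : u₁ ≤ U)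
    (ha : ContinuousOn a (Icc 0 U)) (hb : ContinuousOn b (Icc 0 U))
    (hφa : ContinuousOn φa (Icc 0 U)) (hφb : ContinuousOn φb (Icc 0 U))
    (hΦac : ContinuousOn (fun s => 4 * s * a₁ s + γ * s * a s) (Icc 0 U))
    (hΦbc : ContinuousOn (fun s => 4 * s * b₁ s + γ * s * b s) (Icc 0 U))
    (hPac : ContinuousOn (fun s => s * φa₁ s) (Icc 0 U)) (hPbc : ContinuousOn (fun s => s * φb₁ s) (Icc 0 U))
    (hφa0 : φa 0 = 0) (hφb0 : φb 0 = 0)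
    (hdera : ∀ u ∈ Ioo 0 U, HasDerivAt a (a₁ u) u) (hderb : ∀ u ∈ Ioo 0 U, HasDerivAt b (b₁ u) u)
    (hderφa : ∀ u ∈ Ioo 0 U, HasDerivAt φa (φa₁ u) u) (hderφb : ∀ u ∈ Ioo 0 U, HasDerivAt φb (φb₁ u) u)
    (hΦa : ∀ u ∈ Ioo 0 U, HasDerivAt (fun s => 4 * s * a₁ s + γ * s * a s)
      (m ^ 2 / u * a u - m * (ρ + Rc * ((1 - Real.exp (-(γ * u / 4))) / (2 * Real.pi * u))) * b u
        + γ * m * Rc / 2 * (γ / (4 * Real.pi) * Real.exp (-(γ * u / 4))) * φb u - f₁ u) u)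
    (hΦb : ∀ u ∈ Ioo 0 U, HasDerivAt (fun s => 4 * s * b₁ s + γ * s * b s)
      (m ^ 2 / u * b u + m * (ρ + Rc * ((1 - Real.exp (-(γ * u / 4))) / (2 * Real.pi * u))) * a u
        - γ * m * Rc / 2 * (γ / (4 * Real.pi) * Real.exp (-(γ * u / 4))) * φa u - f₂ u) u)
    (hPa : ∀ u ∈ Ioo 0 U, HasDerivAt (fun s => s * φa₁ s) ((m ^ 2 / u * φa u - a u) / 4) u)
    (hPb : ∀ u ∈ Ioo 0 U, HasDerivAt (fun s => s * φb₁ s) ((m ^ 2 / u * φb u - b u) / 4) u)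
    (hφaU : φa U = 0) (hφbU : φb U = 0)
    (hIΩ : IntervalIntegrable (fun u => Real.exp (γ * u / 4)
      * ((1 - Real.exp (-(γ * u / 4))) / (2 * Real.pi * u)) * (a u ^ 2 + b u ^ 2)) volume 0 U)
    (hIE : IntervalIntegrable (fun u => Real.exp (γ * u / 4) * (a u ^ 2 + b u ^ 2)) volume 0 U)
    (hIf : IntervalIntegrable (fun u => Real.exp (γ * u / 4) * (a u * f₂ u - b u * f₁ u)) volume 0 U)
    (hIaφ : IntervalIntegrable (fun u => a u * φa u) volume 0 U)
    (hIbφ : IntervalIntegrable (fun u => b u * φb u) volume 0 U)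
    (hIBa₁ : IntervalIntegrable (fun u => 4 * u * φa₁ u ^ 2) volume 0 U)
    (hIBa₂ : IntervalIntegrable (fun u => m ^ 2 / u * φa u ^ 2) volume 0 U)
    (hIBb₁ : IntervalIntegrable (fun u => 4 * u * φb₁ u ^ 2) volume 0 U)
    (hIBb₂ : IntervalIntegrable (fun u => m ^ 2 / u * φb u ^ 2) volume 0 U)
    (hIua : IntervalIntegrable (fun u => u * a u ^ 2) volume 0 U)
    (hIub : IntervalIntegrable (fun u => u * b u ^ 2) volume 0 U) :
    (1 - 16 / (5 * m ^ 2)) * (m * Rc) * (∫ u in (0:ℝ)..u₁, Real.exp (γ * u / 4)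
        * ((1 - Real.exp (-(γ * u / 4))) / (2 * Real.pi * u)) * (a u ^ 2 + b u ^ 2))
      + m * ρ * (∫ u in (0:ℝ)..u₁, Real.exp (γ * u / 4) * (a u ^ 2 + b u ^ 2))
      ≤ (∫ u in (0:ℝ)..u₁, Real.exp (γ * u / 4) * (a u * f₂ u - b u * f₁ u))
        + Real.exp (γ * u₁ / 4) * (a u₁ * (4 * u₁ * b₁ u₁ + γ * u₁ * b u₁) - b u₁ * (4 * u₁ * a₁ u₁ + γ * u₁ * a u₁))
        + γ ^ 2 * Rc / (16 * Real.pi * m) * ∫ u in u₁..U, u * (a u ^ 2 + b u ^ 2) := by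
  have hm0 : 0 < m := by linarith
  have hm0' : m ≠ 0 := hm0.ne'
  have hπ : 0 < Real.pi := Real.pi_pos
  have hU : 0 ≤ U := hu₁.trans hu₁U
  -- truncated integrability
  have hIΩ' := intervalIntegrable_mono_left hu₁ hu₁U hIΩ
  have hIE' := intervalIntegrable_mono_left hu₁ hu₁U hIE
  have hIua' := intervalIntegrable_mono_left hu₁ hu₁U hIua
  have hIub' := intervalIntegrable_mono_left hu₁ hu₁U hIub
  -- the V-integrand splits as `mρ·E s + mRc·EΩ s`
  have hIV : IntervalIntegrable (fun u => Real.exp (γ * u / 4)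
      * (m * (ρ + Rc * ((1 - Real.exp (-(γ * u / 4))) / (2 * Real.pi * u))) * (a u ^ 2 + b u ^ 2))) volume 0 U := by
    have e : (fun u => Real.exp (γ * u / 4)
        * (m * (ρ + Rc * ((1 - Real.exp (-(γ * u / 4))) / (2 * Real.pi * u))) * (a u ^ 2 + b u ^ 2)))
        = fun u => m * ρ * (Real.exp (γ * u / 4) * (a u ^ 2 + b u ^ 2))
          + m * Rc * (Real.exp (γ * u / 4) * ((1 - Real.exp (-(γ * u / 4))) / (2 * Real.pi * u)) * (a u ^ 2 + b u ^ 2)) := by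
      funext u; ring
    rw [e]
    exact (hIE.const_mul (m * ρ)).add (hIΩ.const_mul (m * Rc))
  have hVsplit : ∫ u in (0:ℝ)..u₁, Real.exp (γ * u / 4)
      * (m * (ρ + Rc * ((1 - Real.exp (-(γ * u / 4))) / (2 * Real.pi * u))) * (a u ^ 2 + b u ^ 2))
      = m * ρ * (∫ u in (0:ℝ)..u₁, Real.exp (γ * u / 4) * (a u ^ 2 + b u ^ 2))
        + m * Rc * (∫ u in (0:ℝ)..u₁, Real.exp (γ * u / 4)
          * ((1 - Real.exp (-(γ * u / 4))) / (2 * Real.pi * u)) * (a u ^ 2 + b u ^ 2)) := by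
    rw [← intervalIntegral.integral_const_mul, ← intervalIntegral.integral_const_mul,
      ← integral_add (hIE'.const_mul _) (hIΩ'.const_mul _)]
    congr 1; funext u; ring
  -- (1) the truncated identity
  have hid := core_rotation_identity_trunc hu₁ hu₁U ha hb hΦac hΦbc hdera hderb hΦa hΦb hIV hIf (hIaφ.add hIbφ)
  -- (2) truncated Biot–Savart pairing bounds
  have hBa := bsPairing_trunc_le hm0' hu₁ hu₁U hφa hPac hφa0 hderφa hPa hφaU hIaφ hIBa₁ hIBa₂ hIua
  have hBb := bsPairing_trunc_le hm0' hu₁ hu₁U hφb hPbc hφb0 hderφb hPb hφbU hIbφ hIBb₁ hIBb₂ hIub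
  have hbs_sum : ∫ u in (0:ℝ)..u₁, (a u * φa u + b u * φb u)
      = (∫ u in (0:ℝ)..u₁, a u * φa u) + ∫ u in (0:ℝ)..u₁, b u * φb u :=
    integral_add (intervalIntegrable_mono_left hu₁ hu₁U hIaφ) (intervalIntegrable_mono_left hu₁ hu₁U hIbφ)
  have hext_sum : ∫ u in u₁..U, u * (a u ^ 2 + b u ^ 2) = (∫ u in u₁..U, u * a u ^ 2) + ∫ u in u₁..U, u * b u ^ 2 := by
    rw [← integral_add (intervalIntegrable_mono_right hu₁ hu₁U hIua) (intervalIntegrable_mono_right hu₁ hu₁U hIub)]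
    congr 1; funext u; ring
  -- (3) pointwise rotation/Biot–Savart comparison on the core
  have hcomp : γ ^ 2 * m * Rc / (8 * Real.pi) * (1 / m ^ 2) * ((∫ u in (0:ℝ)..u₁, u * a u ^ 2) + ∫ u in (0:ℝ)..u₁, u * b u ^ 2)
      ≤ 16 / (5 * m ^ 2) * (m * Rc) * (∫ u in (0:ℝ)..u₁, Real.exp (γ * u / 4)
          * ((1 - Real.exp (-(γ * u / 4))) / (2 * Real.pi * u)) * (a u ^ 2 + b u ^ 2)) := by
    rw [← integral_add hIua' hIub', ← intervalIntegral.integral_const_mul, ← intervalIntegral.integral_const_mul]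
    apply integral_mono_on hu₁ ((hIua'.add hIub').const_mul _) (hIΩ'.const_mul _)
    intro u hu
    have hs : 0 ≤ a u ^ 2 + b u ^ 2 := by positivity
    have hpt := bs_rotation_pointwise hγ hm hu.1
    have hE : Real.exp (γ * u / 4) * ((1 - Real.exp (-(γ * u / 4))) / (2 * Real.pi * u))
        = (Real.exp (γ * u / 4) - 1) / (2 * Real.pi * u) := by
      have : Real.exp (γ * u / 4) * Real.exp (-(γ * u / 4)) = 1 := by rw [← Real.exp_add]; simp
      rw [mul_div_assoc', mul_sub, mul_one, this]
    have lhs_eq : γ ^ 2 * m * Rc / (8 * Real.pi) * (1 / m ^ 2) * (u * a u ^ 2 + u * b u ^ 2)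
        = Rc * (γ ^ 2 / (8 * Real.pi * m) * u) * (a u ^ 2 + b u ^ 2) := by
      field_simp
    have rhs_eq : 16 / (5 * m ^ 2) * (m * Rc) * (Real.exp (γ * u / 4)
          * ((1 - Real.exp (-(γ * u / 4))) / (2 * Real.pi * u)) * (a u ^ 2 + b u ^ 2))
        = Rc * (16 / (5 * m ^ 2) * m * ((Real.exp (γ * u / 4) - 1) / (2 * Real.pi * u))) * (a u ^ 2 + b u ^ 2) := by
      rw [hE]; ring
    rw [lhs_eq, rhs_eq]
    exact mul_le_mul_of_nonneg_right (mul_le_mul_of_nonneg_left hpt hRc) hs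
  -- assemble
  have hRcm : 0 ≤ γ ^ 2 * m * Rc / (8 * Real.pi) := by positivity
  have hbs_le : γ ^ 2 * m * Rc / (8 * Real.pi) * ∫ u in (0:ℝ)..u₁, (a u * φa u + b u * φb u)
      ≤ 16 / (5 * m ^ 2) * (m * Rc) * (∫ u in (0:ℝ)..u₁, Real.exp (γ * u / 4)
          * ((1 - Real.exp (-(γ * u / 4))) / (2 * Real.pi * u)) * (a u ^ 2 + b u ^ 2))
        + γ ^ 2 * Rc / (16 * Real.pi * m) * ∫ u in u₁..U, u * (a u ^ 2 + b u ^ 2) := by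
    have h1 : ∫ u in (0:ℝ)..u₁, (a u * φa u + b u * φb u)
        ≤ (1 / m ^ 2) * ((∫ u in (0:ℝ)..u₁, u * a u ^ 2) + ∫ u in (0:ℝ)..u₁, u * b u ^ 2)
          + 1 / (2 * m ^ 2) * ((∫ u in u₁..U, u * a u ^ 2) + ∫ u in u₁..U, u * b u ^ 2) := by
      rw [hbs_sum]; linarith [hBa, hBb]
    have h2 := mul_le_mul_of_nonneg_left h1 hRcm
    have h3 : γ ^ 2 * m * Rc / (8 * Real.pi) * (1 / (2 * m ^ 2) * ((∫ u in u₁..U, u * a u ^ 2) + ∫ u in u₁..U, u * b u ^ 2))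
        = γ ^ 2 * Rc / (16 * Real.pi * m) * ∫ u in u₁..U, u * (a u ^ 2 + b u ^ 2) := by
      rw [hext_sum]; field_simp; ring
    calc γ ^ 2 * m * Rc / (8 * Real.pi) * ∫ u in (0:ℝ)..u₁, (a u * φa u + b u * φb u)
        ≤ γ ^ 2 * m * Rc / (8 * Real.pi) * ((1 / m ^ 2) * ((∫ u in (0:ℝ)..u₁, u * a u ^ 2) + ∫ u in (0:ℝ)..u₁, u * b u ^ 2)
          + 1 / (2 * m ^ 2) * ((∫ u in u₁..U, u * a u ^ 2) + ∫ u in u₁..U, u * b u ^ 2)) := h2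
      _ = γ ^ 2 * m * Rc / (8 * Real.pi) * (1 / m ^ 2) * ((∫ u in (0:ℝ)..u₁, u * a u ^ 2) + ∫ u in (0:ℝ)..u₁, u * b u ^ 2)
          + γ ^ 2 * m * Rc / (8 * Real.pi) * (1 / (2 * m ^ 2) * ((∫ u in u₁..U, u * a u ^ 2) + ∫ u in u₁..U, u * b u ^ 2)) := by
          ring
      _ ≤ _ := by rw [h3]; linarith [hcomp]
  rw [hVsplit] at hid
  nlinarith [hid, hbs_le]

end Summit.NavierStokesRegularity.NavierStokesRegularity.Theorems.DefectColumnGate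

end
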